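import Literature.AlgebraicGeometry.Deformation.SmoothSchemeLiftObstructionCechCocycleIdentity
import Literature.AlgebraicGeometry.Morphisms.CechModuleH2ScalingVanishing
import HarnessLib

/-!
# The obstruction cochain of lifted transition data is a Čech coboundary under scaling relations
# (the `[n]^*`-weight argument for «abelian varieties are unobstructed», Čech form)

Layer `Literature/AlgebraicGeometry/Deformation`, namespace `Literature.AlgebraicGeometry.Deformation` (THEOREMS only: no
definition, no instance, no notation, no named fact).

THE PRINT. [Hartshorne2010, Thm. 10.2 (proof), p. 81]: the obstruction to extending a deformation `X'/C` of a smooth `X₀/k`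
over a small extension `0 → J → C' → C → 0` is the class in `H²(X₀, 𝒯_{X₀} ⊗ J)` of the Čech `2`-cocycle of discrepancies
`ψ'_{jk} ψ'_{ij} ψ'_{ik}⁻¹` of lifted transition automorphisms; it vanishes iff that cocycle is a coboundary `d¹γ`, and then
the `ψ'` can be corrected to glue.  [Oort1971, §2.2] ∕ [MumfordAV1970, §13 Cor. 2 with §4 (iv)]: for an abelian variety the
endomorphism `[n]` acts with weight `n` on `H⁰(Ω¹)`-type classes and weight `n²` on the obstruction, and since the
obstruction is functorial the two weights clash unless the class is zero («abelian varieties are unobstructed»).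

THIS FILE isolates the Čech-algebra end of that argument, in the currency of ★ `SmoothSchemeLiftObstructionCechCocycleIdentity`
(F2: `X/Spec k` with `k`-structures `halg`, principal affine cover `U b hb`, `A' ⊇ J, 𝔫'`, `e : J ≅ k`, lifted data `ψ hψ`,
obstruction cochain `o` characterised by `ho`) and ★ `Morphisms/CechModuleH2ScalingVanishing`:
* `obstructionCochain_mem_cechMZ2` — ★ `obstructionCochain_cocycle` read as `o ∈ Z²(U, 𝒯_X)` of the ordered module Čech complex;
* `exists_cechMD1_eq_of_scaling_slots` — given a frame `π σ` of `𝒯_X` (`∑ π_a σ_a = 𝟙`), a refinement `W →_τ U` covering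
  every `U i`, and per component `2`-cocycles `p a, q a` of `𝒪_X` on `W` with `[p a] = 2 • [q a]`, `[q a] = [(π_a o)|_W]`,
  `[p a] = (2·2) • [(π_a o)|_W]` (`k ⊇ ℚ`), the cochain `o` is a coboundary: `∃ γ, d¹γ = o`.
The three relations are supplied, for the closed fibre of an abelian scheme and `[2]`, by the functoriality of the
obstruction cochain along `[2]` (`[p] = 2[q]`), its independence of the cover (`[q] = [z]`) and `[2]^* = 4` on `Ȟ²(𝒪)`
(`[p] = 4[z]`); nothing in this file depends on how they are obtained.

Cell `hodgecm-mathlib`, F-11 road (a′) (iv-5): HC_CM is proved only modulo the 7 printed citations until rung 0 closes —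
nothing here bears on a summit statement.

## References
* [Hartshorne2010] R. Hartshorne, *Deformation Theory*, GTM 257, Springer (2010): Thm. 10.2 and its proof (p. 81), Cor. 10.3 (p. 82).
* [Oort1971] F. Oort, *Finite group schemes, local moduli for abelian varieties, and lifting problems*, Compositio Math. 23
  (1971): §2.2, Thm. 2.2.1 and its proof (abelian varieties are unobstructed).
* [MumfordAV1970] D. Mumford, *Abelian Varieties* (1970): §4 (iv) (`[n]^*` on invariant forms), §13 Cor. 2.
-/

noncomputable section

-- `TopCat.Presheaf`/`TopCat.Sheaf` are not reducible (as in Mathlib's `AlgebraicGeometry/Modules`).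
set_option backward.isDefEq.respectTransparency false

open CategoryTheory AlgebraicGeometry Opposite TopologicalSpace Limits
open scoped TensorProduct

universe u v

namespace Literature.AlgebraicGeometry.Deformation

open Literature.AlgebraicGeometry.HodgeTheory Literature.AlgebraicGeometry.Modules
  Literature.AlgebraicGeometry.Motives Literature.AlgebraicGeometry.Morphisms SmoothAffineDeformation

variable {k : Type u} [Field k] {X : Over (Spec (CommRingCat.of k))}
  [instΓ : ∀ W : X.left.Opens, Algebra k Γ(X.left, W)]
  (halg : ∀ (W : X.left.Opens) (s : k), algebraMap k Γ(X.left, W) s = (constToPresheaf X).app (op W) s)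
  {A' : Type u} [CommRing A'] [Algebra k A']
  (J 𝔫' : Ideal A') (hJ : J * J = ⊥) (hJ𝔫 : J * 𝔫' = ⊥) (e : ↥(J.restrictScalars k) ≃ₗ[k] k)
  {ι : Type u} (U : ι → X.left.affineOpens) (b : (j l : ι) → Γ(X.left, (U j).1))
  (hb : ∀ j l, (U j).1 ⊓ (U l).1 = X.left.basicOpen (b j l))

/-! ## §1 Bridge: the F2 obstruction cochain is a `2`-cocycle of the module Čech complex -/

include halg hb hJ hJ𝔫 in
/-- ★ F2-B `obstructionCochain_cocycle` read as membership in `cechMZ2` (the four-term identity IS `d² o = 0` for the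
ordered module Čech complex of ★ `Morphisms/CechModuleH2`, up to proof-irrelevant inclusion proofs).
[cite: Hartshorne2010, Thm. 10.2 (proof), p. 81] -/
theorem obstructionCochain_mem_cechMZ2 (h𝔫 : IsNilpotent 𝔫')
    (ψ : (j l : ι) → A' ⊗[k] Γ(X.left, (U j).1 ⊓ (U l).1) ≃ₐ[A'] A' ⊗[k] Γ(X.left, (U j).1 ⊓ (U l).1))
    (hψ : ∀ j l x, ψ j l x - x ∈ 𝔫' • (⊤ : Submodule A' (A' ⊗[k] Γ(X.left, (U j).1 ⊓ (U l).1))))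
    (o : CechMC2 X.hom (tangentSheaf X) (fun j => (U j).1))
    (ho : ∀ (j l m : ι)
      (Φjl : A' ⊗[k] Γ(X.left, (U j).1 ⊓ (U l).1) →ₐ[A'] A' ⊗[k] Γ(X.left, (U j).1 ⊓ (U l).1 ⊓ (U m).1))
      (_ : ∀ a s, Φjl (a ⊗ₜ s) = a ⊗ₜ X.left.presheaf.map (homOfLE inf_le_left).op s)
      (Φlm : A' ⊗[k] Γ(X.left, (U l).1 ⊓ (U m).1) →ₐ[A'] A' ⊗[k] Γ(X.left, (U j).1 ⊓ (U l).1 ⊓ (U m).1))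
      (_ : ∀ a s, Φlm (a ⊗ₜ s) = a ⊗ₜ X.left.presheaf.map
        (homOfLE (le_inf (inf_le_left.trans inf_le_right) inf_le_right)).op s)
      (Φjm : A' ⊗[k] Γ(X.left, (U j).1 ⊓ (U m).1) →ₐ[A'] A' ⊗[k] Γ(X.left, (U j).1 ⊓ (U l).1 ⊓ (U m).1))
      (_ : ∀ a s, Φjm (a ⊗ₜ s) = a ⊗ₜ X.left.presheaf.map
        (homOfLE (le_inf (inf_le_left.trans inf_le_left) inf_le_right)).op s)
      (ρjl ρlm ρjm : A' ⊗[k] Γ(X.left, (U j).1 ⊓ (U l).1 ⊓ (U m).1) ≃ₐ[A']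
        A' ⊗[k] Γ(X.left, (U j).1 ⊓ (U l).1 ⊓ (U m).1)),
      (∀ x, ρjl (Φjl x) = Φjl (ψ j l x)) → (∀ x, ρlm (Φlm x) = Φlm (ψ l m x)) →
      (∀ x, ρjm (Φjm x) = Φjm (ψ j m x)) →
      ∀ c : Γ(X.left, (U j).1 ⊓ (U l).1 ⊓ (U m).1), (ρlm * ρjl * ρjm⁻¹) ((1 : A') ⊗ₜ c) =
        (1 : A') ⊗ₜ c + ((e.symm 1 : ↥(J.restrictScalars k)) : A') ⊗ₜ
          (show Γ(X.left, (U j).1 ⊓ (U l).1 ⊓ (U m).1) from appLE (o j l m) (𝟙 _) (dSection X _ c))) :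
    o ∈ cechMZ2 X.hom (tangentSheaf X) (fun j => (U j).1) := by
  rw [mem_cechMZ2_iff]
  funext j l m n
  exact obstructionCochain_cocycle halg J 𝔫' hJ hJ𝔫 e U b hb h𝔫 ψ hψ o ho j l m n

/-! ## §2 The obstruction cochain is a coboundary, from a frame and the three scaling relations -/

include halg hb hJ hJ𝔫 in
/-- **THE OBSTRUCTION COCHAIN IS A ČECH COBOUNDARY, FROM A FRAME OF `𝒯_X` AND THE THREE SCALING RELATIONS**
(the «`[n]^*` acts by `n` on `H¹(Ω¹)`-type classes and by `n²` on the obstruction» argument for the unobstructedness of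
abelian varieties, in Čech currency).  Data: `X/k` smooth (`k ⊇ ℚ`) with a principal affine cover `U`, `A' ⊇ J, 𝔫'`
(`J² = J𝔫' = 0`, `𝔫'` nilpotent, `e : J ≅ k`), lifted transition automorphisms `ψ` (`≡ 1 mod 𝔫'`) and their obstruction
cochain `o` in the characterised form `ho` of ★ `exists_cocycle_lifts_of_eq_cechMD1`; a FRAME `π σ` of the tangent sheaf
(`∑ π_a σ_a = 𝟙 𝒯_X`, e.g. `𝒯 ≅ 𝒪^g` for an abelian variety); a refinement `W →_τ U` by opens covering every `U i`; and for
every component `a` two `2`-cocycles `p a, q a` of `𝒪_X` on `W` with `[p a] = 2 • [q a]`, `[q a] = [(π_a o)|_W]` and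
`[p a] = (2·2) • [(π_a o)|_W]` in `Ȟ²(W, 𝒪_X)`.  Then `o = d¹γ` for some `1`-cochain `γ` of `𝒯_X` on `U` — the input
`(γ, hγ)` of ★ `exists_cocycle_lifts_of_eq_cechMD1` (so the lifted data can be corrected to a cocycle and the deformation
extends).  Proof: `o ∈ Z²` (`obstructionCochain_mem_cechMZ2`) and ★ `mem_cechMB2_of_componentwise_scaling_relations`
with `n = 2` (`2·2 − 2` is a unit). [cite: Oort1971, §2.2 (Thm. 2.2.1 and its proof)] [cite: MumfordAV1970, §13 Cor. 2]
[cite: Hartshorne2010, Thm. 10.2 (proof), p. 81] -/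
theorem exists_cechMD1_eq_of_scaling_slots [Algebra ℚ k] (h𝔫 : IsNilpotent 𝔫')
    (ψ : (j l : ι) → A' ⊗[k] Γ(X.left, (U j).1 ⊓ (U l).1) ≃ₐ[A'] A' ⊗[k] Γ(X.left, (U j).1 ⊓ (U l).1))
    (hψ : ∀ j l x, ψ j l x - x ∈ 𝔫' • (⊤ : Submodule A' (A' ⊗[k] Γ(X.left, (U j).1 ⊓ (U l).1))))
    (o : CechMC2 X.hom (tangentSheaf X) (fun j => (U j).1))
    (ho : ∀ (j l m : ι)
      (Φjl : A' ⊗[k] Γ(X.left, (U j).1 ⊓ (U l).1) →ₐ[A'] A' ⊗[k] Γ(X.left, (U j).1 ⊓ (U l).1 ⊓ (U m).1))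
      (_ : ∀ a s, Φjl (a ⊗ₜ s) = a ⊗ₜ X.left.presheaf.map (homOfLE inf_le_left).op s)
      (Φlm : A' ⊗[k] Γ(X.left, (U l).1 ⊓ (U m).1) →ₐ[A'] A' ⊗[k] Γ(X.left, (U j).1 ⊓ (U l).1 ⊓ (U m).1))
      (_ : ∀ a s, Φlm (a ⊗ₜ s) = a ⊗ₜ X.left.presheaf.map
        (homOfLE (le_inf (inf_le_left.trans inf_le_right) inf_le_right)).op s)
      (Φjm : A' ⊗[k] Γ(X.left, (U j).1 ⊓ (U m).1) →ₐ[A'] A' ⊗[k] Γ(X.left, (U j).1 ⊓ (U l).1 ⊓ (U m).1))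
      (_ : ∀ a s, Φjm (a ⊗ₜ s) = a ⊗ₜ X.left.presheaf.map
        (homOfLE (le_inf (inf_le_left.trans inf_le_left) inf_le_right)).op s)
      (ρjl ρlm ρjm : A' ⊗[k] Γ(X.left, (U j).1 ⊓ (U l).1 ⊓ (U m).1) ≃ₐ[A']
        A' ⊗[k] Γ(X.left, (U j).1 ⊓ (U l).1 ⊓ (U m).1)),
      (∀ x, ρjl (Φjl x) = Φjl (ψ j l x)) → (∀ x, ρlm (Φlm x) = Φlm (ψ l m x)) →
      (∀ x, ρjm (Φjm x) = Φjm (ψ j m x)) →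
      ∀ c : Γ(X.left, (U j).1 ⊓ (U l).1 ⊓ (U m).1), (ρlm * ρjl * ρjm⁻¹) ((1 : A') ⊗ₜ c) =
        (1 : A') ⊗ₜ c + ((e.symm 1 : ↥(J.restrictScalars k)) : A') ⊗ₜ
          (show Γ(X.left, (U j).1 ⊓ (U l).1 ⊓ (U m).1) from appLE (o j l m) (𝟙 _) (dSection X _ c)))
    -- a frame of the tangent sheaf
    {g : ℕ} (π : Fin g → (tangentSheaf X ⟶ SheafOfModules.unit X.left.ringCatSheaf))
    (σ : Fin g → (SheafOfModules.unit X.left.ringCatSheaf ⟶ tangentSheaf X)) (hπσ : ∑ a, π a ≫ σ a = 𝟙 _)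
    -- a refinement `W` of `U` by opens covering every `U i` (e.g. the common principal refinement of `U` and `[2]⁻¹U`)
    {κ : Type v} (W : κ → X.left.Opens) (τ : κ → ι) (hτ : ∀ j, W j ≤ (U (τ j)).1) (hUW : ∀ i, (U i).1 ≤ ⨆ j, W j)
    -- the cocycles `p a` («`[2]^*(π_a o)|_W`») and `q a` («`(π_a o′)|_W`») with the three scaling relations
    (p q : Fin g → ↥(cechMZ2 X.hom (SheafOfModules.unit X.left.ringCatSheaf) W))
    (rel₁ : ∀ a, CechMH2.mk X.hom _ W (p a) = (2 : k) • CechMH2.mk X.hom _ W (q a))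
    (rel₂ : ∀ a, CechMH2.mk X.hom _ W (q a) = CechMH2.mk X.hom _ W
      ⟨cechMRefineC2 X.hom _ (fun j => (U j).1) W τ hτ (cechMapC2 X.hom (π a) _ o),
        refineMC2_mem_cechMZ2 X.hom _ _ W τ hτ (mapC2_mem_cechMZ2 X.hom (π a) _
          (obstructionCochain_mem_cechMZ2 halg J 𝔫' hJ hJ𝔫 e U b hb h𝔫 ψ hψ o ho))⟩)
    (rel₃ : ∀ a, CechMH2.mk X.hom _ W (p a) = ((2 : k) * 2) • CechMH2.mk X.hom _ W
      ⟨cechMRefineC2 X.hom _ (fun j => (U j).1) W τ hτ (cechMapC2 X.hom (π a) _ o),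
        refineMC2_mem_cechMZ2 X.hom _ _ W τ hτ (mapC2_mem_cechMZ2 X.hom (π a) _
          (obstructionCochain_mem_cechMZ2 halg J 𝔫' hJ hJ𝔫 e U b hb h𝔫 ψ hψ o ho))⟩) :
    ∃ γ : CechMC1 X.hom (tangentSheaf X) (fun j => (U j).1),
      cechMD1 X.hom (tangentSheaf X) (fun j => (U j).1) γ = o := by
  have ho₂ := obstructionCochain_mem_cechMZ2 halg J 𝔫' hJ hJ𝔫 e U b hb h𝔫 ψ hψ o ho
  have hmem : o ∈ cechMB2 X.hom (tangentSheaf X) (fun j => (U j).1) :=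
    mem_cechMB2_of_componentwise_scaling_relations X.hom (fun j => (U j).1) W τ hτ IsAffineLocalizing.unit
      (fun j => (U j).2) hUW π σ hπσ ho₂ (2 : k) isUnit_two_mul_two_sub_two
      fun a => ⟨p a, q a, rel₁ a, rel₂ a, rel₃ a⟩
  exact (mem_cechMB2_iff X.hom (tangentSheaf X) _ o).mp hmem


end Literature.AlgebraicGeometry.Deformation

end
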